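import Literature.Claims.NS.Chae2007
import Literature.Claims.NS.ClayR3EnstrophyBridge
import Literature.Analysis.FluidPDE.AxisymmetricEuler
import Literature.Analysis.FluidPDE.NSVorticityBKMHolds
import Literature.Analysis.FluidPDE.ClassicalBKMSupNormContinuation
import Literature.Analysis.FluidPDE.NSLerayHopfSereginEnergyProofs
import HarnessLib

/-!
# Claim skeleton C140 — Zhen Su (苏震), «Finite-Time Blowup of the 3D Incompressible Navier–Stokes
# Equations via Local Harmonic Analysis and Axisymmetric Initial Data» (Zenodo, «v2: Rigorous Full
# Proof», 2026-05-08, 10 pp.)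

Cell `ns-claims` (D-0090 NS-CLAIMS SWEEP), claim **C140** (T3 QUICK, NEG / Clay-(C) direction;
RULINGS v1.34 (2)), typist `ns-claims-typist-5` g6 (lanes: sources lit-3 g7; refuter refuter-7 g3,
second refuter-1 g4; referee ref-3 g5 (pre-read banked by ref-4 g4); 2-READ typist-10 g4; salvage
salvage-p2 g5; writer-2). UNREFEREED CLAIM under adjudication — NOTHING in this file asserts a
printed step: every printed assertion is a `def … : Prop`; the `theorem`s are the kernel composition
of the paper's own implications, the Clay bridge, and plumbing about the tree's own objects.

Text of record: Zenodo record 20078410, file `18v5main.pdf` (sha256[:16] d73aaf5a78d10ffd; version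
«v2: Rigorous Full Proof», created 2026-05-08, of concept 10.5281/zenodo.20051974), 10 pp., English,
PDF page = printed page; the author's marginal line numbers l.1–l.217 are printed and quoted as «p.N
l.M»; census pin `pub/ns-claims/census/texts/SuZhen2026/pages/p0NN.txt` [SuZhen2026].

## Claimed statement (as printed)

Theorem 6.1, p.9 l.181–184: «There exists explicit, compactly supported smooth divergence-free
axisymmetric initial data u₀ ∈ C₀^∞(ℝ³) such that the corresponding strong solution to the three-
dimensional incompressible Navier–Stokes equations ceases to be smooth in finite time.» Setting p.1
l.2: `∂ₜu + (u·∇)u = −∇p + Δu`, `∇·u = 0` on `ℝ³` (viscosity `1`, no force), `u(·,0) = u₀ ∈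
C₀^∞(ℝ³)`. The ONLY printed witness is the §5 field, p.7 l.150–151: «u = (0, u_θ(r,z), 0), u_θ(r,z)
= A Φ(r,z) tanh(z) + δ₀z» with `Φ(r,z) = φ(r)φ(z)`, `φ` the standard bump (l.149), `δ₀ = 0.1` (p.8
l.158), the amplitude `A` constrained only by l.161–162. Typed: `ClaimedTheorem` — some datum of the
printed class (`IsPrintedClass`: `C^∞`, compactly supported, divergence free, axisymmetric) has a
local regular solution on some `[0, T)`, `T < ∞`, that does NOT continue in the class past `T`
(`CeasesToBeSmooth`, over the cell's BKM class `Chae2007.IsLocalSolution` and the tree's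
continuation notion `HasSobolevExtensionPast` — the paper's own criterion is BKM [1], p.9 l.179).

## Clay delta (reference `ClayVariants.lean`)

Nearest: (C) `NavierStokesBreakdownR3`. Domain `ℝ³` = · viscosity `1` (one viscosity suffices for
(C)) · force `≡ 0` (stronger than (C) needs) · data `C₀^∞ ⊂` class (4)
(`HasRapidSpatialDecay.of_hasCompactSupport`) · «ceases to be smooth in finite time» ⇒ no Clay
solution from `u₀` (uniqueness + persistence of regularity, Tao 2013 Cor. 11.4 / 11.1 in the tree).
**No delta**: `clay_of_claimed : ClaimedTheorem → NavierStokesBreakdownR3` is PROVED below.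

## Step table (print order; the typist's private flags live in the CARD; nothing asserted)

* §2 pp.2–6 («18-layer reverse recursive derivation», numeric intervals for `C_mor, C_tr, C_sob, U₀,
  …`, conclusion l.111 «258 ≤ C_total ≤ 266») and §3 Lemmas 3.1–3.2 (Whitney covering with overlap
  8; Calderón–Zygmund decomposition «C_CZ ≤ 2») print no defined mathematical object that the path
  consumes except through the constant of l.145; not typed separately (recorded).
* `Step4_KeyIneq` · §4 p.7 l.136–145 · for the strong solution: on every ball, `d/dt H_loc ≥ (c₀ −
  C_d − C_b) H_loc` with «C_d + C_b ≤ 263.34», `c₀` any pointwise stretching constant (`ω·∇u·ω ≥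
  c₀|ω|²`, l.146–147/l.162) — solution grain, quantified over local regular solutions from the
  printed datum.
* `Step5a_Smooth` · `Step5b_Support` · `Step5c_DivFree` · `Step5d_Axisym` · p.8 l.152–153 «This
  field is of class C^∞, compactly supported in {0 ≤ r ≤ 1, |z| ≤ 1}, and divergence-free» (+
  «axisymmetric», l.150 / Thm 6.1) — one decl per clause, on the ONE printed field `datum A`;
  `Step5b_Profile` is the same support clause read on the printed cylindrical component `u_θ`
  (bridge `step5b_profile_of_support`). **CARD-PREDICTED LOCATOR: `Step5b_Support`.**
* `Step5e_DzFormula` · p.8 l.157 «∂_z u_θ = A Φ(r,z) sech²(z) + δ₀» (function grain, the printed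
  profile).
* `Step5f_DzPos` · p.8 l.158–159 «∂_z u_θ ≥ δ₀ > 0 holds pointwise everywhere».
* `Step5g_DzLower` · p.8 l.160–161 «Φ_min = min Φ ≈ 0.1353 … ∂_z u_θ ≥ 0.056837A + δ₀».
* `Step5h_StretchDatum` · p.8 l.162 «∂_z u_θ > 263.34, ω·∇u·ω ≥ c₀|ω|², c₀ > 263.34» for the datum
  (via l.154–156 «ω·∇u·ω = ω_z² ∂_z u_θ»); `Step5h_StretchSol` = the same bound ALONG THE SOLUTION
  for all times, which is what §4/§6 consume (l.144 with l.146–147).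
* `Step6_Growth` · §6 p.8 l.165 – p.9 l.173 · patching: the local inequalities at rate `α > 0` ⇒
  `H(t) ≥ H₀ e^{(α/8)t}` («Upon redefining α ← α/8», l.172).
* `Step6b_SupGrowth` · p.9 l.175–178 · «maximum principle … ‖ω(t)‖_{L^∞} ≥ c₁ e^{αt/2}».
* `Step6c_ExpIntegral` · p.9 l.179 «c₁ ∫₀^{T*} e^{αt/2} dt = ∞» — typed at the solution's horizon
  `T` (the print introduces `T*` only here; real-variable grain).
* BKM itself ([1], l.179) is a THEOREM of the tree (`beale_kato_majda_holds`), used by name in the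
  composition; the implicit «the corresponding strong solution [exists]» (l.182–183) is
  `Step0_LocalSolution`.

COMPOSITION — PROVED: `claim_of_steps : Step5a → Step5b → Step5c → Step5d → Step0 → Step4 →
Step5h_StretchSol → Step6_Growth → Step6b_SupGrowth → Step6c_ExpIntegral → ClaimedTheorem` (for any
amplitude `A`; BKM by the tree theorem). `Step5e/5f/5g/5h_StretchDatum` and `Step5b_Profile` are
recorded faces for the verdict table.

TYPING NOTE (vacuity, for the verdict table): every solution-grain step (`Step0`, `Step4`,
`Step5h_StretchSol`, `Step6*`) quantifies over local regular solutions `IsLocalSolution 1 T (datum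
A) u p` FROM THE PRINTED FIELD; such a solution has the datum as a finite-energy initial slice,
while the printed profile grows like `δ₀|z|` off the support of `Φ` — if no such solution exists
these steps hold vacuously (and `Step0_LocalSolution` fails). The function-grain steps
`Step5a…5h_StretchDatum` and the real-variable face `Step6c` carry the kernel-decidable content.

WHAT THIS IS NOT: not a claim about NS regularity or blow-up; not a claim about any author beyond
the typed locator.
-/

noncomputable section

open Set Function Filter MeasureTheory
open scoped Topology ENNReal NNReal ContDiff InnerProductSpace

namespace Literature.Claims.NS.SuZhen2026

open Literature.Analysis.FluidPDE
open Literature.Claims.NS.Chae2007 (IsLocalSolution)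

/-! ### Vocabulary (definitions with bodies; nothing asserted) -/

/-- `ℝ³` (plumbing). [folklore] -/
abbrev E3 : Type := EuclideanSpace ℝ (Fin 3)

/-- The standard bump `φ(s) = e^{−1/(1−s²)}` for `|s| < 1`, `0` for `|s| ≥ 1` (p.7 l.149).
[cite: SuZhen2026, §5 p.7 l.149] -/
def bump (s : ℝ) : ℝ := if |s| < 1 then Real.exp (-(1 / (1 - s ^ 2))) else 0

/-- `Φ(r,z) = φ(r)φ(z)` (p.7 l.150). [cite: SuZhen2026, §5 p.7 l.150] -/
def Phi (r z : ℝ) : ℝ := bump r * bump z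

/-- `δ₀ = 0.1` (p.8 l.158: «δ₀ = 0.1 is a uniform positive constant»).
[cite: SuZhen2026, §5 p.8 l.158] -/
def delta0 : ℝ := 1 / 10

/-- The printed azimuthal profile `u_θ(r,z) = A Φ(r,z) tanh(z) + δ₀ z` (p.7 l.151); the amplitude
`A` is left free in print (constrained only by l.161–162, `Admissible`).
[cite: SuZhen2026, §5 p.7 l.151] -/
def uTheta (A r z : ℝ) : ℝ := A * Phi r z * Real.tanh z + delta0 * z

/-- The PRINTED `z`-derivative `∂_z u_θ = A Φ(r,z) sech²(z) + δ₀` (p.8 l.157, «a direct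
computation»; `sech² = 1/cosh²`). [cite: SuZhen2026, §5 p.8 l.157] -/
def dzUThetaPrinted (A r z : ℝ) : ℝ := A * Phi r z / Real.cosh z ^ 2 + delta0

/-- The printed datum as a field on `ℝ³`: «an axisymmetric purely azimuthal velocity field in
cylindrical coordinates `(r, θ, z)`: `u = (0, u_θ(r,z), 0)`» (p.7 l.150–151), i.e. `u(x) = u_θ(r(x),
x₂) e_θ(x)` in the tree's cylindrical frame (`cylRadius`, `eTheta`; the frame carries the tree's
junk value `e_θ = 0` on the axis `r = 0`, where a cylindrical description assigns no Cartesian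
direction). [cite: SuZhen2026, §5 p.7 l.150–151] -/
def datum (A : ℝ) (x : E3) : E3 := uTheta A (cylRadius x) (x 2) • eTheta x

/-- l.161–162: the amplitude makes the printed lower bound beat the dissipation constant, «∂_z u_θ ≥
0.056837A + δ₀», «∂_z u_θ > 263.34» — i.e. `0.056837 A + δ₀ > 263.34`. Not consumed by the
composition (which holds for every `A`); recorded as the printed constraint on `A`.
[cite: SuZhen2026, §5 p.8 l.161–162] -/
def Admissible (A : ℝ) : Prop := (263.34 : ℝ) < 0.056837 * A + delta0

/-- `C_d + C_b ≤ 263.34` — the printed total dissipation constant in the key inequality (p.7 l.145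
«Explicit constant estimation yields C_d + C_b ≤ 263.34»; §2 p.6 l.111–115 prints the interval
`[258, 266]` for the same `C_total = C_d + C_b`). [cite: SuZhen2026, §4 p.7 l.145] -/
def Ctot : ℝ := 263.34

/-- Local enstrophy on a ball, `H_loc(t) = ½ ∫_{B_r} |ω|² dx`, `ω = ∇ × u` (p.7 l.138).
[cite: SuZhen2026, §4 p.7 l.138] -/
def Hloc (u : ℝ → E3 → E3) (x₀ : E3) (r t : ℝ) : ℝ :=
  (1 / 2) * ∫ x in Metric.ball x₀ r, ‖curl (u t) x‖ ^ 2

/-- Global enstrophy `H(t) = ½ ∫_{ℝ³} |ω|² dx` (p.6 l.124). [cite: SuZhen2026, §3 p.6 l.124] -/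
def Hglob (u : ℝ → E3 → E3) (t : ℝ) : ℝ :=
  (1 / 2) * ∫ x, ‖curl (u t) x‖ ^ 2

/-- The vortex-stretching density `ω·∇u·ω = ω·(Du ω)` (p.7 l.137 integrand, p.8 l.155, l.162).
[cite: SuZhen2026, §4 p.7 l.137; §5 p.8 l.155] -/
def stretchQ (v : E3 → E3) (x : E3) : ℝ := ⟪curl v x, fderiv ℝ v x (curl v x)⟫_ℝ

/-- `‖ω(t)‖_{L^∞(Ω)}` (p.9 l.178–179) as the `ℝ≥0∞`-valued supremum `⨆ x ‖ω(t,x)‖ₑ` — the tree's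
junk-free rendering of the `L^∞` norm in the Beale–Kato–Majda statement (`beale_kato_majda`).
[cite: SuZhen2026, §6 p.9 l.178] -/
def supVort (u : ℝ → E3 → E3) (t : ℝ) : ℝ≥0∞ := ⨆ x, ‖curl (u t) x‖ₑ

/-- **The printed class of the datum** (Thm 6.1 p.9 l.181–182 «explicit, compactly supported smooth
divergence-free axisymmetric initial data u₀ ∈ C₀^∞(ℝ³)»; p.8 l.152–153).
[cite: SuZhen2026, Thm 6.1 p.9 l.181–182] -/
def IsPrintedClass (u₀ : E3 → E3) : Prop :=
  ContDiff ℝ ∞ u₀ ∧ HasCompactSupport u₀ ∧ VectorCalculus.IsDivFree u₀ ∧ IsAxisymmetric u₀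

/-- **«the corresponding strong solution … ceases to be smooth in finite time»** (Thm 6.1 p.9
l.182–184), rendered in the cell's BKM class: some local regular solution from `u₀` on `[0, T)`, `0
< T < ∞` (`Chae2007.IsLocalSolution 1 T u₀ u p`: classical on `[0,T)`, initial slice `u₀`, all `L²`
Sobolev norms bounded on every `[0, T'']`, `T'' < T`) has NO continuation in the class past `T`
(`HasSobolevExtensionPast`, the Beale–Kato–Majda continuation notion — the paper's criterion [1],
l.179). [cite: SuZhen2026, Thm 6.1 p.9 l.182–184] -/
def CeasesToBeSmooth (u₀ : E3 → E3) : Prop :=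
  ∃ T : ℝ, 0 < T ∧ ∃ (u : ℝ → E3 → E3) (p : ℝ → E3 → ℝ),
    IsLocalSolution 1 T u₀ u p ∧ ¬ HasSobolevExtensionPast 1 u T

/-- **Theorem 6.1 (p.9 l.181–184), as printed.** [claim: SuZhen2026, status: disputed] -/
def ClaimedTheorem : Prop :=
  ∃ u₀ : E3 → E3, IsPrintedClass u₀ ∧ CeasesToBeSmooth u₀

/-! ### The paper's steps (no assertion); `A` = the amplitude of the printed field -/

/-- **IMPLICIT — «the corresponding strong solution» (p.9 l.182–183):** a local regular solution
from the printed datum exists on some `[0, T)` (classical local well-posedness, invoked tacitly).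
[claim: SuZhen2026, status: disputed] -/
def Step0_LocalSolution (A : ℝ) : Prop :=
  ∃ T : ℝ, 0 < T ∧ ∃ (u : ℝ → E3 → E3) (p : ℝ → E3 → ℝ), IsLocalSolution 1 T (datum A) u p

/-- **§4, p.7 l.136–145 — the key local differential inequality** («Let B_r ⊂ Ω be an arbitrary
local ball … the boundary integral satisfies the rigorous bound |∫_{∂B_r}(½|ω|²u·n − ω·∇ω·n)dS| ≤
C_b∫_{B_r}|ω|² … d/dt H_loc(t) ≥ (c₀ − C_d − C_b) H_loc(t) … C_d + C_b ≤ 263.34»), where `c₀` is a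
pointwise lower bound for the stretching, `ω·∇u·ω ≥ c₀|ω|²` (l.146–147, l.162). Typed at the grain
printed — for the strong solution (every local regular solution from the printed datum, viscosity
`1`), every ball, every `t ∈ (0,T)`. [claim: SuZhen2026, status: disputed] -/
def Step4_KeyIneq (A : ℝ) : Prop :=
  ∀ (T : ℝ) (u : ℝ → E3 → E3) (p : ℝ → E3 → ℝ), IsLocalSolution 1 T (datum A) u p →
    ∀ c₀ : ℝ, (∀ t ∈ Ico 0 T, ∀ x, c₀ * ‖curl (u t) x‖ ^ 2 ≤ stretchQ (u t) x) →
      ∀ (x₀ : E3) (r : ℝ), 0 < r → ∀ t ∈ Ioo 0 T,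
        (c₀ - Ctot) * Hloc u x₀ r t ≤ deriv (fun s => Hloc u x₀ r s) t

/-- **§5, p.8 l.152 — «This field is of class C^∞»** (the printed field `datum A`).
[claim: SuZhen2026, status: disputed] -/
def Step5a_Smooth (A : ℝ) : Prop :=
  ContDiff ℝ ∞ (datum A)

/-- **§5, p.8 l.152 — «compactly supported in {0 ≤ r ≤ 1, |z| ≤ 1}»**: the printed field vanishes at
every point with `r > 1` or `|z| > 1`. CARD-PREDICTED LOCATOR.
[claim: SuZhen2026, status: disputed] -/
def Step5b_Support (A : ℝ) : Prop :=
  ∀ x : E3, 1 < cylRadius x ∨ 1 < |x 2| → datum A x = 0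

/-- The same clause read on the printed cylindrical component (p.7 l.151 with p.8 l.152): `u_θ(r,z)
= 0` whenever `r > 1` or `|z| > 1` (`r > 0`: off the axis the field and its azimuthal component
vanish together, `step5b_profile_of_support`). Functions face of `Step5b_Support`.
[claim: SuZhen2026, status: disputed] -/
def Step5b_Profile (A : ℝ) : Prop :=
  ∀ r z : ℝ, 0 < r → 1 < r ∨ 1 < |z| → uTheta A r z = 0

/-- **§5, p.8 l.153 — «divergence-free: ∇·u ≡ 0»** (the printed field).
[claim: SuZhen2026, status: disputed] -/
def Step5c_DivFree (A : ℝ) : Prop :=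
  VectorCalculus.IsDivFree (datum A)

/-- **§5, p.7 l.150 / Thm 6.1 — «axisymmetric»** (the printed field; rotations about the `z`-axis,
`IsAxisymmetric`). [claim: SuZhen2026, status: disputed] -/
def Step5d_Axisym (A : ℝ) : Prop :=
  IsAxisymmetric (datum A)

/-- **§5, p.8 l.157 — «A direct computation yields ∂_z u_θ = A Φ(r,z) sech²(z) + δ₀»**, as the
derivative of the printed profile in `z`. [claim: SuZhen2026, status: disputed] -/
def Step5e_DzFormula (A : ℝ) : Prop :=
  ∀ r z : ℝ, 0 ≤ r → HasDerivAt (fun s => uTheta A r s) (dzUThetaPrinted A r z) z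

/-- **§5, p.8 l.158–159 — «∂_z u_θ ≥ δ₀ > 0 holds pointwise everywhere, including on the boundary of
the support»**. [claim: SuZhen2026, status: disputed] -/
def Step5f_DzPos (A : ℝ) : Prop :=
  ∀ r z : ℝ, 0 ≤ r → delta0 ≤ deriv (fun s => uTheta A r s) z

/-- **§5, p.8 l.160–161 — «Define Φ_min = min Φ ≈ 0.1353, min_{|z|≤1} sech²(z) ≈ 0.41997. Then ∂_z
u_θ ≥ 0.056837A + δ₀»** (everywhere, as l.158–159). [claim: SuZhen2026, status: disputed] -/
def Step5g_DzLower (A : ℝ) : Prop :=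
  ∀ r z : ℝ, 0 ≤ r → 0.056837 * A + delta0 ≤ deriv (fun s => uTheta A r s) z

/-- **§5, p.8 l.162 — «∂_z u_θ > 263.34, ω·∇u·ω ≥ c₀|ω|², c₀ > 263.34, as required»** for the DATUM
(via l.154–156 «ω_r = −∂_z u_θ, ω_θ = 0, ω_z = r⁻¹∂_r(ru_θ)», «ω·∇u·ω = ω_z² ∂_z u_θ»): a pointwise
stretching bound with a constant above the dissipation constant, on the printed field. Functions
face. [claim: SuZhen2026, status: disputed] -/
def Step5h_StretchDatum (A : ℝ) : Prop :=
  ∃ c₀ : ℝ, Ctot < c₀ ∧ ∀ x : E3, c₀ * ‖curl (datum A) x‖ ^ 2 ≤ stretchQ (datum A) x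

/-- **l.162 as consumed by §4/§6 (l.144 with l.146–147 «initial data that admits a pointwise uniform
lower bound for the vortex stretching term: c₀ > 263.34», used in `d/dt H_loc ≥ (c₀ − C_d −
C_b)H_loc` for all `t`)**: along every local regular solution from the printed datum, `ω·∇u·ω ≥
c₀|ω|²` pointwise on `[0,T) × ℝ³` with one `c₀ > 263.34`. Solution grain.
[claim: SuZhen2026, status: disputed] -/
def Step5h_StretchSol (A : ℝ) : Prop :=
  ∀ (T : ℝ) (u : ℝ → E3 → E3) (p : ℝ → E3 → ℝ), IsLocalSolution 1 T (datum A) u p →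
    ∃ c₀ : ℝ, Ctot < c₀ ∧ ∀ t ∈ Ico 0 T, ∀ x, c₀ * ‖curl (u t) x‖ ^ 2 ≤ stretchQ (u t) x

/-- **§6, p.8 l.165 – p.9 l.173 — patching and exponential growth** («H(t) ≤ 8 sup_j H_loc^{(j)}(t)
… each local patch satisfies H′_loc ≥ αH_loc … H′(t) ≥ (α/8)H(t) … Upon redefining α ← α/8 … H(t) ≥
H₀e^{αt}»): the local inequalities at rate `α > 0` on every ball imply `H(t) ≥ H(0) e^{(α/8)t}` on
`[0,T)`, along every local regular solution from the printed datum.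
[claim: SuZhen2026, status: disputed] -/
def Step6_Growth (A : ℝ) : Prop :=
  ∀ (T : ℝ) (u : ℝ → E3 → E3) (p : ℝ → E3 → ℝ), IsLocalSolution 1 T (datum A) u p →
    ∀ α : ℝ, 0 < α →
      (∀ (x₀ : E3) (r : ℝ), 0 < r → ∀ t ∈ Ioo 0 T,
          α * Hloc u x₀ r t ≤ deriv (fun s => Hloc u x₀ r s) t) →
        ∀ t ∈ Ico 0 T, Hglob u 0 * Real.exp (α / 8 * t) ≤ Hglob u t

/-- **§6, p.9 l.175–178 — «Thanks to the uniform pointwise positivity ∂_z u_θ ≥ δ₀ > 0, the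
vorticity admits a maximum principle and cannot concentrate on sets of smaller measure than the
support of u₀. There thus exists a constant c₁ > 0, independent of t, such that ‖ω(t)‖_{L^∞(Ω)} ≥
c₁e^{αt/2}»**: exponential enstrophy growth at rate `α` ⇒ the sup bound, along every local regular
solution from the printed datum. [claim: SuZhen2026, status: disputed] -/
def Step6b_SupGrowth (A : ℝ) : Prop :=
  ∀ (T : ℝ) (u : ℝ → E3 → E3) (p : ℝ → E3 → ℝ), IsLocalSolution 1 T (datum A) u p →
    ∀ α : ℝ, 0 < α → (∀ t ∈ Ico 0 T, Hglob u 0 * Real.exp (α * t) ≤ Hglob u t) →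
      ∃ c₁ : ℝ, 0 < c₁ ∧ ∀ t ∈ Ico 0 T, ENNReal.ofReal (c₁ * Real.exp (α * t / 2)) ≤ supVort u t

/-- **§6, p.9 l.179 — «∫₀^{T*} ‖ω(t)‖_{L^∞(Ω)} dt ≥ c₁ ∫₀^{T*} e^{αt/2} dt = ∞»**, the printed
EQUALITY `c₁∫₀^{T*} e^{αt/2} dt = ∞`, read at the horizon `T` of the strong solution at hand (the
print introduces `T*` only in this display; «finite-time blowup», l.180): for every local regular
solution from the printed datum on `[0,T)` and all `c₁, α > 0`, the lower integral of `c₁e^{αt/2}`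
over `(0,T)` is infinite. Real-variable grain. [claim: SuZhen2026, status: disputed] -/
def Step6c_ExpIntegral (A : ℝ) : Prop :=
  ∀ (T : ℝ) (u : ℝ → E3 → E3) (p : ℝ → E3 → ℝ), IsLocalSolution 1 T (datum A) u p →
    ∀ c₁ α : ℝ, 0 < c₁ → 0 < α →
      (∫⁻ t in Ioo 0 T, ENNReal.ofReal (c₁ * Real.exp (α * t / 2))) = ⊤

/-! ### Plumbing about the tree's objects (proved; no printed step is asserted) -/

/-- Off the axis, the printed field vanishes iff its azimuthal profile does: the support clause on
the field (p.8 l.152) gives the support clause on `u_θ` (p.7 l.151) — evaluate at `(r, 0, z)`, where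
`e_θ = (0,1,0)` (SuZhen2026: §5 p.7 l.151, p.8 l.152). [claim: SuZhen2026, status: disputed] -/
theorem step5b_profile_of_support (A : ℝ) (h : Step5b_Support A) : Step5b_Profile A := by
  intro r z hr hout
  -- the point `x = (r, 0, z)`
  set x : E3 := WithLp.toLp 2 ![r, 0, z] with hx
  have hx0 : x 0 = r := rfl
  have hx1 : x 1 = 0 := rfl
  have hx2 : x 2 = z := rfl
  have hrad : cylRadius x = r := by
    rw [cylRadius, hx0, hx1]
    simp [Real.sqrt_sq hr.le]
  have hval := h x (by rw [hrad, hx2]; exact hout)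
  -- component `1` of `datum A x` is `u_θ(r,z) · (r⁻¹ · r) = u_θ(r,z)`
  have h1 : datum A x 1 = uTheta A r z := by
    simp only [datum, eTheta, hrad, hx2, PiLp.smul_apply, smul_eq_mul]
    show uTheta A r z * (r⁻¹ * (WithLp.toLp 2 ![-x 1, x 0, 0] : E3) 1) = uTheta A r z
    have : (WithLp.toLp 2 ![-x 1, x 0, 0] : E3) 1 = r := by rw [← hx0]; rfl
    rw [this, inv_mul_cancel₀ hr.ne', mul_one]
  have := congrArg (fun v : E3 => v 1) hval
  simpa [h1] using this

/-- `R_θ (c • v) = c • R_θ v` (the rotation is linear). [folklore] -/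
private theorem rotZ_smul (θ c : ℝ) (v : E3) : rotZ θ (c • v) = c • rotZ θ v := by
  ext i
  fin_cases i <;> simp [rotZ] <;> ring

/-- The angular unit vector is equivariant under rotations about the axis, `e_θ(R_θ x) = R_θ
e_θ(x)`. [folklore] -/
private theorem eTheta_rotZ' (θ : ℝ) (x : E3) : eTheta (rotZ θ x) = rotZ θ (eTheta x) := by
  rw [eTheta, eTheta, cylRadius_rotZ, rotZ_smul]
  congr 1
  ext i
  fin_cases i <;> simp [rotZ] <;> ring

/-- **`Step5d_Axisym` HOLDS** (kernel fact about the printed formula: any field `f(r, z) e_θ` is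
axisymmetric — `r` and `z` are rotation invariant and `e_θ` is rotation equivariant). A TRUE clause
of l.150–153, recorded; it does not bear on the locator. [claim: SuZhen2026, status: disputed] -/
theorem step5d_holds (A : ℝ) : Step5d_Axisym A := by
  intro θ x
  simp only [datum, cylRadius_rotZ, rotZ_apply_two, eTheta_rotZ', rotZ_smul]

/-- `Step5d_Axisym` holds for all parameters — `_holds` alias of `step5d_holds` above under the fact's exact name
(appended 2026-08-28, D-0026 bookkeeping: the proof term is the existing theorem of this file; no statement,
definition or attribute is edited; no new named fact; the ledger's debt table listed the fact
unproved). [claim: SuZhen2026, status: disputed] -/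
theorem _root_.Literature.Claims.NS.SuZhen2026.Step5d_Axisym_holds (A : ℝ) : Step5d_Axisym A :=
  _root_.Literature.Claims.NS.SuZhen2026.step5d_holds A

/-! ### Composition (the paper's own implications, in the kernel) -/

/-- **COMPOSITION — PROVED.** For any amplitude `A`: the printed class of the datum (l.152–153 +
l.150), the tacit local solution (l.182–183), the key inequality §4 with the stretching bound l.162
along the solution (`α = c₀ − 263.34 > 0`), patching §6 (`H ≥ H₀e^{(α/8)t}`), the sup bound
l.175–178 and the printed divergence l.179 give, with the tree's Beale–Kato–Majda theorem
(`beale_kato_majda_holds`: continuation past `T` ⇔ `∫₀ᵀ‖ω‖_∞ < ∞`), a strong solution that does not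
continue past its horizon — Theorem 6.1. [claim: SuZhen2026, status: disputed] -/
theorem claim_of_steps (A : ℝ) (h5a : Step5a_Smooth A) (h5b : Step5b_Support A)
    (h5c : Step5c_DivFree A) (h5d : Step5d_Axisym A) (h0 : Step0_LocalSolution A)
    (h4 : Step4_KeyIneq A) (h5h : Step5h_StretchSol A) (h6 : Step6_Growth A)
    (h6b : Step6b_SupGrowth A) (h6c : Step6c_ExpIntegral A) : ClaimedTheorem := by
  -- the printed class: compact support from the cylinder clause
  have hK : IsCompact {x : E3 | cylRadius x ≤ 1 ∧ |x 2| ≤ 1} := by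
    refine Metric.isCompact_of_isClosed_isBounded ?_ ?_
    · exact (isClosed_le continuous_cylRadius continuous_const).inter
        (isClosed_le (continuous_abs.comp (EuclideanSpace.proj (2 : Fin 3)).continuous)
          continuous_const)
    · refine (Metric.isBounded_closedBall (x := (0 : E3)) (r := 2)).subset fun x hx => ?_
      rw [Metric.mem_closedBall, dist_zero_right, EuclideanSpace.norm_eq]
      have hsum : ∑ i : Fin 3, ‖x i‖ ^ 2 = x 0 ^ 2 + x 1 ^ 2 + x 2 ^ 2 := by
        simp [Fin.sum_univ_three, Real.norm_eq_abs, sq_abs]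
      rw [hsum]
      have h1 : x 0 ^ 2 + x 1 ^ 2 ≤ 1 := by
        have := hx.1
        have h0 := cylRadius_nonneg x
        nlinarith [cylRadius_sq x]
      have h2 : x 2 ^ 2 ≤ 1 := by
        have := hx.2
        nlinarith [abs_nonneg (x 2), sq_abs (x 2)]
      calc Real.sqrt (x 0 ^ 2 + x 1 ^ 2 + x 2 ^ 2) ≤ Real.sqrt 4 :=
            Real.sqrt_le_sqrt (by linarith)
        _ = 2 := by rw [show (4 : ℝ) = 2 ^ 2 by norm_num, Real.sqrt_sq (by norm_num)]
  have hsupp : HasCompactSupport (datum A) := by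
    refine HasCompactSupport.intro hK fun x hx => h5b x ?_
    simpa only [mem_setOf_eq, not_and_or, not_le] using hx
  refine ⟨datum A, ⟨h5a, hsupp, h5c, h5d⟩, ?_⟩
  -- the blow-up chain along the tacit local solution
  obtain ⟨T, hT, u, p, hsol⟩ := h0
  obtain ⟨c₀, hc₀, hstretch⟩ := h5h T u p hsol
  have hα : 0 < c₀ - Ctot := sub_pos.2 hc₀
  have hloc := h4 T u p hsol c₀ hstretch
  have hgrow := h6 T u p hsol (c₀ - Ctot) hα hloc
  have hgrow' : ∀ t ∈ Ico 0 T, Hglob u 0 * Real.exp ((c₀ - Ctot) / 8 * t) ≤ Hglob u t := hgrow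
  obtain ⟨c₁, hc₁, hsup⟩ := h6b T u p hsol ((c₀ - Ctot) / 8) (by positivity) hgrow'
  have hint := h6c T u p hsol c₁ ((c₀ - Ctot) / 8) hc₁ (by positivity)
  refine ⟨T, hT, u, p, hsol, fun hext => ?_⟩
  -- BKM: continuation past `T` forces `∫₀ᵀ ‖ω‖_∞ < ∞`, but the integrand dominates `c₁e^{αt/2}`
  have hbkm := (beale_kato_majda_holds zero_le_one hT hsol.isClassical hsol.sobolev).1 hext
  have hle : (∫⁻ t in Ioo 0 T, ENNReal.ofReal (c₁ * Real.exp ((c₀ - Ctot) / 8 * t / 2))) ≤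
      ∫⁻ t in Ioo 0 T, ⨆ x, ‖curl (u t) x‖ₑ :=
    lintegral_mono_ae ((ae_restrict_iff' measurableSet_Ioo).2
      (Filter.Eventually.of_forall fun t ht => hsup t ⟨ht.1.le, ht.2⟩))
  rw [hint, top_le_iff] at hle
  exact absurd hle hbkm.ne

/-! ### The Clay bridge (proved) -/

/-- **`ClaimedTheorem` ⇒ Clay (C)** (`NavierStokesBreakdownR3`). A `C₀^∞` datum is of class (4)
(`HasRapidSpatialDecay.of_hasCompactSupport`); if `(1, 0, u₀)` were Clay-solvable, the Clay solution
`w` (classical on `ℝ³ × [0,∞)`, bounded energy) would lie in the Sobolev class on `[0, T+1]`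
(persistence, Tao 2013 Cor. 11.1: `hasBoundedSobolevNormsOn_of_sobolevDatum_unforced`) and agree
with the strong solution `u` on `[0, T)` (uniqueness, Cor. 11.4: `eq_of_finiteEnergy_closed_slab`),
i.e. `u` WOULD continue in the class past `T`. So `u₀` has no Clay solution at viscosity `1`, and
`navierStokesBreakdownR3_of_not_solvable` concludes.
[cite: FeffermanClay2006, (C) with (4)–(7) p. 2]
[cite: Tao2011, Cor. 11.1 + Cor. 11.4 (arXiv Cor. 68, 71)] -/
theorem clay_of_claimed (h : ClaimedTheorem) :
    Summit.NavierStokesRegularity.NavierStokesRegularity.NavierStokesBreakdownR3 := by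
  obtain ⟨u₀, ⟨hsm, hcs, hdiv, -⟩, T, hT, u, p, hsol, hno⟩ := h
  have hdec : HasRapidSpatialDecay u₀ := HasRapidSpatialDecay.of_hasCompactSupport hsm hcs
  refine ClayVariants.navierStokesBreakdownR3_of_not_solvable one_pos hsm (fun x => hdiv x) hdec
    ClayVariants.isSmoothOnHalfSpace_zero ClayVariants.clayR3_force_zero fun hS => hno ?_
  obtain ⟨w, q, hw, hw0, hwE⟩ := ClayVariants.clayR3_solvable_zero_iff_classical.mp hS
  have hT1 : (0 : ℝ) < T + 1 := by linarith
  have hwT : IsClassicalNSSolutionOn (Icc 0 (T + 1)) 1 0 w q :=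
    hw.mono Icc_subset_Ici_self (uniqueDiffOn_Icc hT1)
  have hwE' : ∃ B : ℝ≥0∞, B < ⊤ ∧ ∀ t ∈ Icc 0 (T + 1), ∫⁻ x, ‖w t x‖ₑ ^ 2 ≤ B := by
    obtain ⟨C, hC, hb⟩ := hwE
    exact ⟨C, hC, fun t ht => hb t ht.1⟩
  have hwE'' : ∃ C : ℝ≥0, ∀ t ∈ Icc 0 (T + 1), ∫⁻ x, ‖w t x‖ₑ ^ 2 ≤ C := by
    obtain ⟨B, hB, hb⟩ := hwE'
    exact ⟨B.toNNReal, fun t ht => (hb t ht).trans (ENNReal.coe_toNNReal hB.ne).ge⟩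
  have h₀ : ∀ m : ℕ, ∫⁻ x, ‖iteratedFDeriv ℝ m (w 0) x‖ₑ ^ 2 < ⊤ := fun m => by
    rw [hw0]; exact ClayVariants.sobolevDatum_of_rapidDecay hdec m
  have hB : HasBoundedSobolevNormsOn (Icc 0 (T + 1)) w :=
    hwT.hasBoundedSobolevNormsOn_of_sobolevDatum_unforced one_pos hT1 hwE'' h₀
  refine ⟨T + 1, by linarith, w, q, hwT.mono Ico_subset_Icc_self (uniqueDiffOn_Ico 0 (T + 1)),
    hB.mono (Icc_subset_Icc_right (by linarith)), fun t ht => ?_⟩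
  exact eq_of_finiteEnergy_closed_slab one_pos hT hsol.isClassical hsol.sobolev hwT
    (hw0.trans hsol.initial.symm) hwE' ht (by linarith [ht.2])

/-! ### Rev 2 (ADDITIVE — referee ref-4 g5 DELTA CHECK 2026-08-27T09:42:55Z note n2 and 2-READ
typist-10 g4 09:48:17Z note (ii); nothing above is touched)

Two corrections of the TYPIST'S OWN TYPING of the downstream display p.9 l.179 (no effect on the
locator of record p.8 l.152–153, on any other Step, or on `claim_of_steps` / `clay_of_claimed`):

* HEADER CORRECTION: the TYPING NOTE sentence «the real-variable face `Step6c` carr[ies] the kernel-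
  decidable content» overstates — `Step6c_ExpIntegral` keeps the solution binder `IsLocalSolution 1
  T (datum A) u p →` and is therefore as vacuous as the other solution-grain steps over the printed
  (non-`L²`) field.
* TYPING ARTEFACT (disclosed, vacuity class of the cell's A-audit; NOT a finding about the print):
  `Chae2007.IsLocalSolution ν T v₀ u p` carries no `0 < T`, and for `T ≤ 0` it holds trivially (`Ico
  0 T = ∅`; e.g. `u := fun _ => datum A`, `p := 0`), while the conclusion of `Step6c_ExpIntegral` at
  such a `T` reads `0 = ⊤`. So `Step6c_ExpIntegral A` is refutable through the EMPTY time interval,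
  for a reason unrelated to l.179. The print-faithful renderings of l.179 are the two decls below:
  the binder-free real-variable face `Step6cR_ExpIntegralReal` (what «c₁∫₀^{T*} e^{αt/2} dt = ∞»
  asserts of a finite `T* > 0`) and the guarded solution-grain face `Step6cP_ExpIntegral` (`0 < T`);
  the composition is re-proved from the guarded face (`claim_of_stepsP`) and from the real face
  (`claim_of_stepsR`). Lanes: do not key `Step6c_ExpIntegral`; use `Step6cR`/`Step6cP`. -/

/-- **§6, p.9 l.179 — «c₁∫₀^{T*} e^{αt/2} dt = ∞» at the pure real-variable grain** (no solution
binder): for all `T, c₁, α > 0` the lower integral of `c₁e^{αt/2}` over `(0,T)` is infinite — what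
the printed equality asserts of a finite blow-up time `T*` («finite-time blowup», l.180). Downstream
LOGIC handle (exponential growth on `[0,T*)` does not make the BKM integral diverge at a finite
`T*`); not the locator. (Independent of the amplitude; indexed by `A` only to keep the uniform
signature of this file's steps.) [claim: SuZhen2026, status: disputed] -/
def Step6cR_ExpIntegralReal (_A : ℝ) : Prop :=
  ∀ T c₁ α : ℝ, 0 < T → 0 < c₁ → 0 < α →
    (∫⁻ t in Ioo 0 T, ENNReal.ofReal (c₁ * Real.exp (α * t / 2))) = ⊤

/-- **§6, p.9 l.179 at the solution grain, GUARDED (`0 < T`)**: for every local regular solution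
from the printed datum on `[0,T)` with `T > 0` and all `c₁, α > 0`, the lower integral of
`c₁e^{αt/2}` over `(0,T)` is infinite. Supersedes `Step6c_ExpIntegral` for the lanes (see the Rev 2
note). [claim: SuZhen2026, status: disputed] -/
def Step6cP_ExpIntegral (A : ℝ) : Prop :=
  ∀ (T : ℝ) (u : ℝ → E3 → E3) (p : ℝ → E3 → ℝ), IsLocalSolution 1 T (datum A) u p → 0 < T →
    ∀ c₁ α : ℝ, 0 < c₁ → 0 < α →
      (∫⁻ t in Ioo 0 T, ENNReal.ofReal (c₁ * Real.exp (α * t / 2))) = ⊤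

/-- The real-variable face implies the guarded solution-grain face (pure logic).
[claim: SuZhen2026, status: disputed] -/
theorem step6cP_of_real (A : ℝ) (h : Step6cR_ExpIntegralReal A) : Step6cP_ExpIntegral A :=
  fun T _u _p _hsol hT c₁ α hc₁ hα => h T c₁ α hT hc₁ hα

/-- The unguarded landed face implies the guarded one (pure logic; recorded so that nothing proved
from `Step6c_ExpIntegral` is lost). [claim: SuZhen2026, status: disputed] -/
theorem step6cP_of_step6c (A : ℝ) (h : Step6c_ExpIntegral A) : Step6cP_ExpIntegral A :=
  fun T u p hsol _hT c₁ α hc₁ hα => h T u p hsol c₁ α hc₁ hα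

/-- **COMPOSITION from the guarded face — PROVED** (same chain as `claim_of_steps`; the tacit local
solution of `Step0_LocalSolution` has `T > 0`, which is all the guard asks).
[claim: SuZhen2026, status: disputed] -/
theorem claim_of_stepsP (A : ℝ) (h5a : Step5a_Smooth A) (h5b : Step5b_Support A)
    (h5c : Step5c_DivFree A) (h5d : Step5d_Axisym A) (h0 : Step0_LocalSolution A)
    (h4 : Step4_KeyIneq A) (h5h : Step5h_StretchSol A) (h6 : Step6_Growth A)
    (h6b : Step6b_SupGrowth A) (h6c : Step6cP_ExpIntegral A) : ClaimedTheorem := by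
  -- the printed class: compact support from the cylinder clause
  have hK : IsCompact {x : E3 | cylRadius x ≤ 1 ∧ |x 2| ≤ 1} := by
    refine Metric.isCompact_of_isClosed_isBounded ?_ ?_
    · exact (isClosed_le continuous_cylRadius continuous_const).inter
        (isClosed_le (continuous_abs.comp (EuclideanSpace.proj (2 : Fin 3)).continuous)
          continuous_const)
    · refine (Metric.isBounded_closedBall (x := (0 : E3)) (r := 2)).subset fun x hx => ?_
      rw [Metric.mem_closedBall, dist_zero_right, EuclideanSpace.norm_eq]
      have hsum : ∑ i : Fin 3, ‖x i‖ ^ 2 = x 0 ^ 2 + x 1 ^ 2 + x 2 ^ 2 := by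
        simp [Fin.sum_univ_three, Real.norm_eq_abs, sq_abs]
      rw [hsum]
      have h1 : x 0 ^ 2 + x 1 ^ 2 ≤ 1 := by
        have := hx.1
        have h0 := cylRadius_nonneg x
        nlinarith [cylRadius_sq x]
      have h2 : x 2 ^ 2 ≤ 1 := by
        have := hx.2
        nlinarith [abs_nonneg (x 2), sq_abs (x 2)]
      calc Real.sqrt (x 0 ^ 2 + x 1 ^ 2 + x 2 ^ 2) ≤ Real.sqrt 4 :=
            Real.sqrt_le_sqrt (by linarith)
        _ = 2 := by rw [show (4 : ℝ) = 2 ^ 2 by norm_num, Real.sqrt_sq (by norm_num)]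
  have hsupp : HasCompactSupport (datum A) := by
    refine HasCompactSupport.intro hK fun x hx => h5b x ?_
    simpa only [mem_setOf_eq, not_and_or, not_le] using hx
  refine ⟨datum A, ⟨h5a, hsupp, h5c, h5d⟩, ?_⟩
  obtain ⟨T, hT, u, p, hsol⟩ := h0
  obtain ⟨c₀, hc₀, hstretch⟩ := h5h T u p hsol
  have hα : 0 < c₀ - Ctot := sub_pos.2 hc₀
  have hloc := h4 T u p hsol c₀ hstretch
  have hgrow := h6 T u p hsol (c₀ - Ctot) hα hloc
  obtain ⟨c₁, hc₁, hsup⟩ := h6b T u p hsol ((c₀ - Ctot) / 8) (by positivity) hgrow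
  have hint := h6c T u p hsol hT c₁ ((c₀ - Ctot) / 8) hc₁ (by positivity)
  refine ⟨T, hT, u, p, hsol, fun hext => ?_⟩
  have hbkm := (beale_kato_majda_holds zero_le_one hT hsol.isClassical hsol.sobolev).1 hext
  have hle : (∫⁻ t in Ioo 0 T, ENNReal.ofReal (c₁ * Real.exp ((c₀ - Ctot) / 8 * t / 2))) ≤
      ∫⁻ t in Ioo 0 T, ⨆ x, ‖curl (u t) x‖ₑ :=
    lintegral_mono_ae ((ae_restrict_iff' measurableSet_Ioo).2
      (Filter.Eventually.of_forall fun t ht => hsup t ⟨ht.1.le, ht.2⟩))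
  rw [hint, top_le_iff] at hle
  exact absurd hle hbkm.ne

/-- **COMPOSITION from the real-variable face — PROVED.** [claim: SuZhen2026, status: disputed] -/
theorem claim_of_stepsR (A : ℝ) (h5a : Step5a_Smooth A) (h5b : Step5b_Support A)
    (h5c : Step5c_DivFree A) (h5d : Step5d_Axisym A) (h0 : Step0_LocalSolution A)
    (h4 : Step4_KeyIneq A) (h5h : Step5h_StretchSol A) (h6 : Step6_Growth A)
    (h6b : Step6b_SupGrowth A) (h6c : Step6cR_ExpIntegralReal A) : ClaimedTheorem :=
  claim_of_stepsP A h5a h5b h5c h5d h0 h4 h5h h6 h6b (step6cP_of_real A h6c)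

end Literature.Claims.NS.SuZhen2026

end
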